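import Mathlib
import Literature.AlgebraicGeometry.Resolution.WeightedBlowupMonomialValuation
import HarnessLib

/-!
# Crux `Persistence` (stmt-ResolutionOfSingularities-16484), KILL CANDIDATE K-C3, piece K3b-N (1/2):
# the `x`-chart `W = k[x, z, t, z²/x, zt/x, t²/x, z³/x²]` of the cusp threefold — CLOSED FORM (saturated semigroup algebra)

Route `ResolutionOfSingularities/HomologicalConductor`, chain w44b (CHAIN v13.2 §V13.10, REFEREE-KC3 L4–L6).
[OURS · L1 w44b] — AI-written, weaker than expert review; not a statement of any manuscript under review.

Inside `K = Frac k[x,z,t] = k(x,z,t)` (`K := FractionRing (MvPolynomial (Fin 3) k)`, `x, z, t` the images of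
`X 0, X 1, X 2`) let

  `W := k[x, z, t, z²x⁻¹, ztx⁻¹, t²x⁻¹, z³x⁻¹x⁻¹]`

(the `x`-chart `A[I/x]` of the blow-up of `A = k[x,y,z,t]/(xy − z³ − t⁴)` along `I = (x, y, z², zt, t²)`,
`y/x − (t²/x)² = z³/x²`; under `x = a⁶, z = a⁴b, t = a³c` it is the invariant ring `k[a,b,c]^{μ₆(1,2,3)}`; the
generator set is spelled EXACTLY as in `…PersistenceKC3TowerInstance.kc3_tower_one_eq`, res-D-pv-043).  This file:

* `exists_hilbertBasis` — the saturated semigroup `S = {(i,j,l) ∈ ℤ × ℕ × ℕ : 6i + 4j + 3l ≥ 0}` is the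
  `ℕ`-span of `(1,0,0), (0,1,0), (0,0,1), (−1,2,0), (−1,1,1), (−1,0,2), (−2,3,0)` (its Hilbert basis);
* `mem_W_iff` — **closed form**: `y ∈ W ⟺ y = g · (x⁻¹)^m` for a polynomial `g ∈ k[x,z,t]` with `6m ≤ ν_w(g)`,
  `ν_w = WeightedBlowup.monomialOrd ![6,4,3]` the monomial (weighted) order (every monomial `x^a z^b t^c` of `g`
  has `6a + 4b + 3c ≥ 6m`) — i.e. `W = k[S]`;
* `isFractionRing_W` — `Frac W = K`.

Part 2 (`…PersistenceKC3Normal`): `W` is integrally closed. Valuation-free, fact-free.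

References: W. Bruns, J. Herzog, *Cohen–Macaulay rings*, CUP 1998 (rev. ed.), Prop. 6.1.2 (normal semigroup rings = saturated
semigroups) [BrunsHerzog1998].
-/

-- single-problem summit: the doubled namespace component `ResolutionOfSingularities` is forced
set_option linter.dupNamespace false

noncomputable section

namespace Summit.ResolutionOfSingularities.ResolutionOfSingularities.Theorems.HomologicalConductor.PersistenceKC3ChartClosedForm

open MvPolynomial Literature.AlgebraicGeometry.Resolution.WeightedBlowup

variable {k : Type} [Field k]

local notation3 "𝕂" => FractionRing (MvPolynomial (Fin 3) k)
local notation3 "ι" => algebraMap (MvPolynomial (Fin 3) k) (FractionRing (MvPolynomial (Fin 3) k))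
local notation3 "𝔵" => algebraMap (MvPolynomial (Fin 3) k) (FractionRing (MvPolynomial (Fin 3) k)) (MvPolynomial.X 0)
local notation3 "𝔷" => algebraMap (MvPolynomial (Fin 3) k) (FractionRing (MvPolynomial (Fin 3) k)) (MvPolynomial.X 1)
local notation3 "𝔱" => algebraMap (MvPolynomial (Fin 3) k) (FractionRing (MvPolynomial (Fin 3) k)) (MvPolynomial.X 2)
/-- The chart ring `W = k[x, z, t, z²x⁻¹, ztx⁻¹, t²x⁻¹, z³x⁻¹x⁻¹] ⊆ k(x,z,t)` — the generator set is spelled EXACTLY as in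
`…PersistenceKC3TowerInstance.kc3_tower_one_eq` (res-D-pv-043) at `x z t := ι X₀, ι X₁, ι X₂` (local notation only). -/
local notation3 "𝕎" => Algebra.adjoin k
  ({algebraMap (MvPolynomial (Fin 3) k) (FractionRing (MvPolynomial (Fin 3) k)) (MvPolynomial.X 0),
    algebraMap (MvPolynomial (Fin 3) k) (FractionRing (MvPolynomial (Fin 3) k)) (MvPolynomial.X 1),
    algebraMap (MvPolynomial (Fin 3) k) (FractionRing (MvPolynomial (Fin 3) k)) (MvPolynomial.X 2),
    algebraMap (MvPolynomial (Fin 3) k) (FractionRing (MvPolynomial (Fin 3) k)) (MvPolynomial.X 1) ^ 2 *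
      (algebraMap (MvPolynomial (Fin 3) k) (FractionRing (MvPolynomial (Fin 3) k)) (MvPolynomial.X 0))⁻¹,
    algebraMap (MvPolynomial (Fin 3) k) (FractionRing (MvPolynomial (Fin 3) k)) (MvPolynomial.X 1) *
      algebraMap (MvPolynomial (Fin 3) k) (FractionRing (MvPolynomial (Fin 3) k)) (MvPolynomial.X 2) *
      (algebraMap (MvPolynomial (Fin 3) k) (FractionRing (MvPolynomial (Fin 3) k)) (MvPolynomial.X 0))⁻¹,
    algebraMap (MvPolynomial (Fin 3) k) (FractionRing (MvPolynomial (Fin 3) k)) (MvPolynomial.X 2) ^ 2 *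
      (algebraMap (MvPolynomial (Fin 3) k) (FractionRing (MvPolynomial (Fin 3) k)) (MvPolynomial.X 0))⁻¹,
    algebraMap (MvPolynomial (Fin 3) k) (FractionRing (MvPolynomial (Fin 3) k)) (MvPolynomial.X 1) ^ 3 *
      (algebraMap (MvPolynomial (Fin 3) k) (FractionRing (MvPolynomial (Fin 3) k)) (MvPolynomial.X 0))⁻¹ *
      (algebraMap (MvPolynomial (Fin 3) k) (FractionRing (MvPolynomial (Fin 3) k)) (MvPolynomial.X 0))⁻¹} :
    Set (FractionRing (MvPolynomial (Fin 3) k)))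

/-- The weights `(6, 4, 3)` of `x, z, t` (local notation only). -/
local notation3 "𝕨" => (![6, 4, 3] : Fin 3 → ℕ)

/-! ## The weight functional and the Hilbert basis of the saturated semigroup -/

/-- `weight (6,4,3) d = 6 d₀ + 4 d₁ + 3 d₂`. [folklore] -/
theorem weight_eq (d : Fin 3 →₀ ℕ) : Finsupp.weight 𝕨 d = 6 * d 0 + 4 * d 1 + 3 * d 2 := by
  rw [Finsupp.weight_apply, Finsupp.sum_fintype _ _ (by simp)]
  simp only [Fin.sum_univ_three, smul_eq_mul, Matrix.cons_val_zero, Matrix.cons_val_one,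
    Matrix.cons_val]
  ring

/-- **Hilbert basis of the saturated semigroup** `S = {(i,j,l) ∈ ℤ × ℕ × ℕ : 6i + 4j + 3l ≥ 0}`: every
element of `S` is an `ℕ`-combination of `(1,0,0), (0,1,0), (0,0,1), (−1,2,0), (−1,1,1), (−1,0,2), (−2,3,0)`
(the exponents of `x, z, t, z²/x, zt/x, t²/x, z³/x²`). Greedy witness: `⌊j/3⌋` copies of `z³/x²`, `⌊l/2⌋`
copies of `t²/x`, one `z²/x` or `zt/x` from the remainders when they weigh `≥ 6`.
[cite: BrunsHerzog1998, Prop. 6.1.2] -/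
theorem exists_hilbertBasis (i : ℤ) (j l : ℕ) (h : 0 ≤ 6 * i + 4 * j + 3 * l) :
    ∃ n₁ n₂ n₃ n₄ n₅ n₆ n₇ : ℕ,
      i = n₁ - n₄ - n₅ - n₆ - 2 * n₇ ∧ j = n₂ + 2 * n₄ + n₅ + 3 * n₇ ∧ l = n₃ + n₅ + 2 * n₆ := by
  have hj : j % 3 = 0 ∨ j % 3 = 1 ∨ j % 3 = 2 := by omega
  have hl : l % 2 = 0 ∨ l % 2 = 1 := by omega
  have hj' : j = 3 * (j / 3) + j % 3 := by omega
  have hl' : l = 2 * (l / 2) + l % 2 := by omega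
  rcases hj with hj | hj | hj <;> rcases hl with hl | hl
  · -- (0,0): no extra
    refine ⟨(i + l / 2 + 2 * (j / 3)).toNat, 0, 0, 0, 0, l / 2, j / 3, ?_, by omega, by omega⟩
    rw [Int.toNat_of_nonneg (by omega)]; omega
  · -- (0,1): no extra
    refine ⟨(i + l / 2 + 2 * (j / 3)).toNat, 0, 1, 0, 0, l / 2, j / 3, ?_, by omega, by omega⟩
    rw [Int.toNat_of_nonneg (by omega)]; omega
  · -- (1,0): no extra
    refine ⟨(i + l / 2 + 2 * (j / 3)).toNat, 1, 0, 0, 0, l / 2, j / 3, ?_, by omega, by omega⟩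
    rw [Int.toNat_of_nonneg (by omega)]; omega
  · -- (1,1): one `zt/x`
    refine ⟨(i + 1 + l / 2 + 2 * (j / 3)).toNat, 0, 0, 0, 1, l / 2, j / 3, ?_, by omega, by omega⟩
    rw [Int.toNat_of_nonneg (by omega)]; omega
  · -- (2,0): one `z²/x`
    refine ⟨(i + 1 + l / 2 + 2 * (j / 3)).toNat, 0, 0, 1, 0, l / 2, j / 3, ?_, by omega, by omega⟩
    rw [Int.toNat_of_nonneg (by omega)]; omega
  · -- (2,1): one `z²/x`
    refine ⟨(i + 1 + l / 2 + 2 * (j / 3)).toNat, 0, 1, 1, 0, l / 2, j / 3, ?_, by omega, by omega⟩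
    rw [Int.toNat_of_nonneg (by omega)]; omega

/-! ## Generators and Laurent monomials of `W` -/

/-- `x ≠ 0` in `K`. [folklore] -/
theorem x_ne_zero : (𝔵 : 𝕂) ≠ 0 :=
  fun h => X_ne_zero (0 : Fin 3) (IsFractionRing.injective (MvPolynomial (Fin 3) k) 𝕂
    (by rw [h, map_zero]))

/-- `ι` is injective. [folklore] -/
theorem algebraMap_injective : Function.Injective (ι : MvPolynomial (Fin 3) k → 𝕂) :=
  IsFractionRing.injective _ _

/-- A product of powers of the seven generators lies in `W`. [folklore] -/
theorem prod_generators_mem (n₁ n₂ n₃ n₄ n₅ n₆ n₇ : ℕ) :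
    (𝔵 : 𝕂) ^ n₁ * 𝔷 ^ n₂ * 𝔱 ^ n₃ * (𝔷 ^ 2 * 𝔵⁻¹) ^ n₄ * (𝔷 * 𝔱 * 𝔵⁻¹) ^ n₅ * (𝔱 ^ 2 * 𝔵⁻¹) ^ n₆ *
      (𝔷 ^ 3 * 𝔵⁻¹ * 𝔵⁻¹) ^ n₇ ∈ 𝕎 := by
  have hg : ∀ y ∈ ({𝔵, 𝔷, 𝔱, 𝔷 ^ 2 * 𝔵⁻¹, 𝔷 * 𝔱 * 𝔵⁻¹, 𝔱 ^ 2 * 𝔵⁻¹, 𝔷 ^ 3 * 𝔵⁻¹ * 𝔵⁻¹} : Set 𝕂),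
      ∀ n : ℕ, y ^ n ∈ 𝕎 :=
    fun y hy n => Subalgebra.pow_mem _ (Algebra.subset_adjoin hy) n
  apply_rules [Subalgebra.mul_mem] <;> simp

/-- `ι (monomial d 1) = x^{d₀} z^{d₁} t^{d₂}`. [folklore] -/
theorem algebraMap_monomial (d : Fin 3 →₀ ℕ) :
    ι (monomial d (1 : k)) = (𝔵 : 𝕂) ^ d 0 * 𝔷 ^ d 1 * 𝔱 ^ d 2 := by
  rw [monomial_eq, C_1, one_mul, Finsupp.prod_fintype _ _ (by simp), Fin.prod_univ_three]
  simp only [map_mul, map_pow]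

/-- **Laurent monomials of non-negative weight lie in `W`**: if `6m ≤ 6d₀ + 4d₁ + 3d₂` then
`x^{d₀} z^{d₁} t^{d₂} · (x⁻¹)^m ∈ W` (the Hilbert basis). [cite: BrunsHerzog1998, Prop. 6.1.2] -/
theorem monomial_mul_inv_pow_mem (d : Fin 3 →₀ ℕ) (m : ℕ) (h : 6 * m ≤ 6 * d 0 + 4 * d 1 + 3 * d 2) :
    ι (monomial d (1 : k)) * (𝔵⁻¹ : 𝕂) ^ m ∈ 𝕎 := by
  rw [algebraMap_monomial]
  obtain ⟨n₁, n₂, n₃, n₄, n₅, n₆, n₇, h₁, h₂, h₃⟩ :=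
    exists_hilbertBasis ((d 0 : ℤ) - m) (d 1) (d 2) (by omega)
  have hsum : d 0 + (n₄ + n₅ + n₆ + 2 * n₇) = n₁ + m := by omega
  have hx : (𝔵 : 𝕂) ≠ 0 := x_ne_zero
  have key : (𝔵 : 𝕂) ^ d 0 * 𝔵⁻¹ ^ m = 𝔵 ^ n₁ * 𝔵⁻¹ ^ (n₄ + n₅ + n₆ + 2 * n₇) := by
    rw [inv_pow, inv_pow, mul_inv_eq_iff_eq_mul₀ (pow_ne_zero _ hx), mul_assoc, mul_comm (_⁻¹), ← mul_assoc,
      eq_mul_inv_iff_mul_eq₀ (pow_ne_zero _ hx), ← pow_add, ← pow_add, hsum]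
  have : (𝔵 : 𝕂) ^ d 0 * 𝔷 ^ d 1 * 𝔱 ^ d 2 * 𝔵⁻¹ ^ m =
      𝔵 ^ n₁ * 𝔷 ^ n₂ * 𝔱 ^ n₃ * (𝔷 ^ 2 * 𝔵⁻¹) ^ n₄ * (𝔷 * 𝔱 * 𝔵⁻¹) ^ n₅ * (𝔱 ^ 2 * 𝔵⁻¹) ^ n₆ *
        (𝔷 ^ 3 * 𝔵⁻¹ * 𝔵⁻¹) ^ n₇ := by
    rw [h₂, h₃]
    calc (𝔵 : 𝕂) ^ d 0 * 𝔷 ^ (n₂ + 2 * n₄ + n₅ + 3 * n₇) * 𝔱 ^ (n₃ + n₅ + 2 * n₆) * 𝔵⁻¹ ^ m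
        = (𝔵 ^ d 0 * 𝔵⁻¹ ^ m) * 𝔷 ^ (n₂ + 2 * n₄ + n₅ + 3 * n₇) * 𝔱 ^ (n₃ + n₅ + 2 * n₆) := by ring
      _ = (𝔵 ^ n₁ * 𝔵⁻¹ ^ (n₄ + n₅ + n₆ + 2 * n₇)) * 𝔷 ^ (n₂ + 2 * n₄ + n₅ + 3 * n₇) *
            𝔱 ^ (n₃ + n₅ + 2 * n₆) := by rw [key]
      _ = _ := by ring
  rw [this]
  exact prod_generators_mem n₁ n₂ n₃ n₄ n₅ n₆ n₇


/-! ## The closed form: `W` = Laurent polynomials `g · (x⁻¹)^m` with `6m ≤ ν_w(g)` -/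

/-- `ν_w(x^m) = 6m`. [folklore] -/
theorem monomialOrd_X_zero_pow (m : ℕ) :
    monomialOrd 𝕨 (X 0 ^ m : MvPolynomial (Fin 3) k) = ((6 * m : ℕ) : ℕ∞) := by
  rw [X_pow_eq_monomial, monomialOrd_monomial _ _ one_ne_zero, Finsupp.weight_single]
  simp only [smul_eq_mul, Matrix.cons_val_zero]
  rw [mul_comm]

/-- `6m ≤ ν_w(g)` iff every monomial `x^a z^b t^c` of `g` has `6m ≤ 6a + 4b + 3c`. [folklore] -/
theorem le_monomialOrd_iff_weight (g : MvPolynomial (Fin 3) k) (n : ℕ) :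
    (n : ℕ∞) ≤ monomialOrd 𝕨 g ↔ ∀ d ∈ g.support, n ≤ 6 * d 0 + 4 * d 1 + 3 * d 2 := by
  rw [le_monomialOrd_iff]
  refine forall₂_congr fun d _ => ?_
  rw [weight_eq]

/-- The Laurent presentations are closed under addition (common denominator `x^{m₁+m₂}`). [folklore] -/
theorem laurent_add {y₁ y₂ : 𝕂}
    (h₁ : ∃ (g : MvPolynomial (Fin 3) k) (m : ℕ), ((6 * m : ℕ) : ℕ∞) ≤ monomialOrd 𝕨 g ∧ y₁ = ι g * 𝔵⁻¹ ^ m)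
    (h₂ : ∃ (g : MvPolynomial (Fin 3) k) (m : ℕ), ((6 * m : ℕ) : ℕ∞) ≤ monomialOrd 𝕨 g ∧ y₂ = ι g * 𝔵⁻¹ ^ m) :
    ∃ (g : MvPolynomial (Fin 3) k) (m : ℕ), ((6 * m : ℕ) : ℕ∞) ≤ monomialOrd 𝕨 g ∧ y₁ + y₂ = ι g * 𝔵⁻¹ ^ m := by
  obtain ⟨g₁, m₁, hw₁, rfl⟩ := h₁
  obtain ⟨g₂, m₂, hw₂, rfl⟩ := h₂
  refine ⟨g₁ * X 0 ^ m₂ + g₂ * X 0 ^ m₁, m₁ + m₂, ?_, ?_⟩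
  · refine le_trans ?_ (min_monomialOrd_le_add _ _ _)
    rw [le_min_iff, monomialOrd_mul, monomialOrd_mul, monomialOrd_X_zero_pow, monomialOrd_X_zero_pow]
    constructor
    · calc (((6 * (m₁ + m₂) : ℕ)) : ℕ∞) = ((6 * m₁ : ℕ) : ℕ∞) + ((6 * m₂ : ℕ) : ℕ∞) := by
            rw [← Nat.cast_add]; congr 1; ring
        _ ≤ monomialOrd 𝕨 g₁ + ((6 * m₂ : ℕ) : ℕ∞) := add_le_add hw₁ le_rfl
    · calc (((6 * (m₁ + m₂) : ℕ)) : ℕ∞) = ((6 * m₂ : ℕ) : ℕ∞) + ((6 * m₁ : ℕ) : ℕ∞) := by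
            rw [← Nat.cast_add]; congr 1; ring
        _ ≤ monomialOrd 𝕨 g₂ + ((6 * m₁ : ℕ) : ℕ∞) := add_le_add hw₂ le_rfl
  · have hx : (𝔵 : 𝕂) ≠ 0 := x_ne_zero
    have h₁ : (𝔵 : 𝕂) ^ m₁ * 𝔵⁻¹ ^ m₁ = 1 := by rw [← mul_pow, mul_inv_cancel₀ hx, one_pow]
    have h₂ : (𝔵 : 𝕂) ^ m₂ * 𝔵⁻¹ ^ m₂ = 1 := by rw [← mul_pow, mul_inv_cancel₀ hx, one_pow]
    rw [map_add, map_mul, map_mul, map_pow, map_pow, pow_add]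
    calc ι g₁ * 𝔵⁻¹ ^ m₁ + ι g₂ * 𝔵⁻¹ ^ m₂
        = ι g₁ * 𝔵⁻¹ ^ m₁ * ((𝔵 : 𝕂) ^ m₂ * 𝔵⁻¹ ^ m₂) + ι g₂ * 𝔵⁻¹ ^ m₂ * ((𝔵 : 𝕂) ^ m₁ * 𝔵⁻¹ ^ m₁) := by
          rw [h₁, h₂, mul_one, mul_one]
      _ = _ := by ring

/-- The Laurent presentations are closed under multiplication. [folklore] -/
theorem laurent_mul {y₁ y₂ : 𝕂}
    (h₁ : ∃ (g : MvPolynomial (Fin 3) k) (m : ℕ), ((6 * m : ℕ) : ℕ∞) ≤ monomialOrd 𝕨 g ∧ y₁ = ι g * 𝔵⁻¹ ^ m)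
    (h₂ : ∃ (g : MvPolynomial (Fin 3) k) (m : ℕ), ((6 * m : ℕ) : ℕ∞) ≤ monomialOrd 𝕨 g ∧ y₂ = ι g * 𝔵⁻¹ ^ m) :
    ∃ (g : MvPolynomial (Fin 3) k) (m : ℕ), ((6 * m : ℕ) : ℕ∞) ≤ monomialOrd 𝕨 g ∧ y₁ * y₂ = ι g * 𝔵⁻¹ ^ m := by
  obtain ⟨g₁, m₁, hw₁, rfl⟩ := h₁
  obtain ⟨g₂, m₂, hw₂, rfl⟩ := h₂
  refine ⟨g₁ * g₂, m₁ + m₂, ?_, ?_⟩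
  · rw [monomialOrd_mul]
    calc (((6 * (m₁ + m₂) : ℕ)) : ℕ∞) = ((6 * m₁ : ℕ) : ℕ∞) + ((6 * m₂ : ℕ) : ℕ∞) := by
          rw [← Nat.cast_add]; congr 1; ring
      _ ≤ monomialOrd 𝕨 g₁ + monomialOrd 𝕨 g₂ := add_le_add hw₁ hw₂
  · rw [map_mul]
    ring

/-- **`W ⊆` Laurent presentations**: every element of `W` is `g · (x⁻¹)^m` with `6m ≤ ν_w(g)` (the seven
generators are, and the presentations form a `k`-subalgebra). [cite: BrunsHerzog1998, Prop. 6.1.2] -/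
theorem exists_laurent_of_mem {y : 𝕂} (hy : y ∈ 𝕎) :
    ∃ (g : MvPolynomial (Fin 3) k) (m : ℕ), ((6 * m : ℕ) : ℕ∞) ≤ monomialOrd 𝕨 g ∧ y = ι g * 𝔵⁻¹ ^ m := by
  induction hy using Algebra.adjoin_induction with
  | mem y hy =>
    simp only [Set.mem_insert_iff, Set.mem_singleton_iff] at hy
    rcases hy with rfl | rfl | rfl | rfl | rfl | rfl | rfl
    · exact ⟨X 0, 0, by simp, by simp⟩
    · exact ⟨X 1, 0, by simp, by simp⟩
    · exact ⟨X 2, 0, by simp, by simp⟩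
    · refine ⟨X 1 ^ 2, 1, ?_, by simp⟩
      rw [le_monomialOrd_iff_weight, support_X_pow]
      intro d hd
      rw [Finset.mem_singleton] at hd
      subst hd
      simp
    · refine ⟨X 1 * X 2, 1, ?_, by simp [mul_assoc]⟩
      rw [monomialOrd_mul, monomialOrd_X, monomialOrd_X]
      simp only [Matrix.cons_val_one, Matrix.cons_val]
      norm_num
    · refine ⟨X 2 ^ 2, 1, ?_, by simp⟩
      rw [le_monomialOrd_iff_weight, support_X_pow]
      intro d hd
      rw [Finset.mem_singleton] at hd
      subst hd
      simp
    · refine ⟨X 1 ^ 3, 2, ?_, by simp [pow_two, mul_assoc]⟩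
      rw [le_monomialOrd_iff_weight, support_X_pow]
      intro d hd
      rw [Finset.mem_singleton] at hd
      subst hd
      simp
  | algebraMap c =>
    refine ⟨C c, 0, by simp, ?_⟩
    rw [IsScalarTower.algebraMap_apply k (MvPolynomial (Fin 3) k) 𝕂 c, MvPolynomial.algebraMap_eq]
    simp
  | add y₁ y₂ _ _ ih₁ ih₂ => exact laurent_add ih₁ ih₂
  | mul y₁ y₂ _ _ ih₁ ih₂ => exact laurent_mul ih₁ ih₂

/-- **Laurent presentations `⊆ W`**: `g · (x⁻¹)^m ∈ W` whenever `6m ≤ ν_w(g)` (monomial by monomial, by the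
Hilbert basis). [cite: BrunsHerzog1998, Prop. 6.1.2] -/
theorem mem_of_laurent (g : MvPolynomial (Fin 3) k) (m : ℕ) (hw : ((6 * m : ℕ) : ℕ∞) ≤ monomialOrd 𝕨 g) :
    ι g * (𝔵⁻¹ : 𝕂) ^ m ∈ 𝕎 := by
  rw [le_monomialOrd_iff_weight] at hw
  rw [g.as_sum, map_sum, Finset.sum_mul]
  refine Subalgebra.sum_mem _ fun d hd => ?_
  have hC : monomial d (coeff d g) = C (coeff d g) * monomial d 1 := by
    rw [C_mul_monomial, mul_one]
  rw [hC, map_mul, ← MvPolynomial.algebraMap_eq,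
    ← IsScalarTower.algebraMap_apply k (MvPolynomial (Fin 3) k) 𝕂]
  convert Subalgebra.smul_mem _ (monomial_mul_inv_pow_mem d m (hw d hd)) (coeff d g) using 1
  rw [Algebra.smul_def, mul_assoc]

/-- **Closed form of `W`**: `y ∈ W = k[x,z,t,z²/x,zt/x,t²/x,z³/x²]` iff `y = g · (x⁻¹)^m` for some polynomial
`g ∈ k[x,z,t]` with `6m ≤ ν_w(g)` (`w = (6,4,3)`), i.e. `W` is the semigroup algebra of the saturated
semigroup `{6i + 4j + 3l ≥ 0}`. [cite: BrunsHerzog1998, Prop. 6.1.2] -/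
theorem mem_W_iff (y : 𝕂) :
    y ∈ 𝕎 ↔ ∃ (g : MvPolynomial (Fin 3) k) (m : ℕ), ((6 * m : ℕ) : ℕ∞) ≤ monomialOrd 𝕨 g ∧ y = ι g * 𝔵⁻¹ ^ m := by
  constructor
  · exact exists_laurent_of_mem
  · rintro ⟨g, m, hw, rfl⟩
    exact mem_of_laurent g m hw

/-! ## `Frac W = K` -/

/-- **`K = k(x,z,t)` is the fraction field of `W`** (`k[x,z,t] ⊆ W`). [folklore] -/
theorem isFractionRing_W : IsFractionRing ↥𝕎 𝕂 := by
  apply IsFractionRing.of_field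
  intro y
  obtain ⟨a, b, -, rfl⟩ := IsFractionRing.div_surjective (A := MvPolynomial (Fin 3) k) y
  have hmem : ∀ g : MvPolynomial (Fin 3) k, ι g ∈ 𝕎 := fun g => by
    simpa using mem_of_laurent g 0 (by simp)
  exact ⟨⟨ι a, hmem a⟩, ⟨ι b, hmem b⟩, rfl⟩


end Summit.ResolutionOfSingularities.ResolutionOfSingularities.Theorems.HomologicalConductor.PersistenceKC3ChartClosedForm

end
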